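import Literature.AlgebraicGeometry.Motives.FibreVerticalLines
import Literature.AlgebraicGeometry.Motives.SubschemeCyclesDimProofs
import Literature.AlgebraicGeometry.Motives.IntegralProjectiveSpace
import HarnessLib

/-!
# Dimension of points of `ℙᴺ ×ₖ B` read in their fibre

For a point `p` of the fibre `ℙᴺ_{κ(b)}` of `pr₂ : ℙᴺ ×ₖ B → B` over `b` (embedded by the fibre
slice `σ_b` of `Motives/FibreVerticalLines`), `dim (σ_b p) = dim b + dim_{κ(b)} p`: the three
dimensions are transcendence degrees of residue fields
(`Literature.AlgebraicGeometry.Motives.Scheme.height_eq_toENat_trdeg_residueField`, Görtz–Wedhorn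
Thm. 5.22) and transcendence degree is additive in the tower `k ⊆ κ(b) ⊆ κ(p) = κ(σ_b p)`
(Stacks 030H). With `Motives/FibreVerticalLines` this identifies the vertical components, over a
curve `Γ ⊆ B` of a two-dimensional base, of the closure of a line of the generic fibre: a point of
dimension `2` over the generic point of `Γ` is the generic point of the `κ(Γ)`-line cut out by the
reduced equations (`ProjFamily.eq_linearSubspacePoint_of_vertical_fibre`). Everything is proved.

## References

* [GortzWedhorn2020] U. Görtz, T. Wedhorn, *Algebraic Geometry I*, 2nd ed., Thm. 5.22.
* [TianZong2014] Z. Tian, H. R. Zong, *One-cycles on rationally connected varieties*, Compositio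
  Math. 150 (2014), proofs of Prop. 3.1 and Prop. 7.2.
-/

noncomputable section

open CategoryTheory CategoryTheory.Limits AlgebraicGeometry MonoidalCategory MvPolynomial
  TopologicalSpace Order

universe u

namespace Literature.AlgebraicGeometry.Motives

attribute [local instance] MvPolynomial.gradedAlgebra MvPolynomial.algebraMvPolynomial
  Literature.AlgebraicGeometry.Motives.ProjBaseChange.algebraBase
  UniversalHyperplaneSection.sectionsAlgebra

namespace ProjFamily

open ProjBaseChangeRing ProjectiveSpaceCells

variable {k : Type u} [Field k] (N : ℕ) (B : SchemeOver k) {U : B.left.Opens} (hU : IsAffineOpen U)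
  (x : U) [Algebra Γ(B.left, U) (IsLocalRing.ResidueField (B.left.presheaf.stalk (x : B.left)))]
  [IsScalarTower Γ(B.left, U) (B.left.presheaf.stalk (x : B.left))
    (IsLocalRing.ResidueField (B.left.presheaf.stalk (x : B.left)))]

/-- **`dim (σ_b p) = dim b + dim_{κ(b)} p`** for a point `p` of the fibre `ℙᴺ_{κ(b)}` of
`ℙᴺ ×ₖ B → B` over `b` (`B` locally of finite type over `k`): the three dimensions are the
transcendence degrees `trdeg_k κ(σ_b p) = trdeg_k κ(p)`, `trdeg_k κ(b)`, `trdeg_{κ(b)} κ(p)`, and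
transcendence degree is additive in towers. [cite: GortzWedhorn2020, Thm. 5.22] -/
theorem height_fibreSlice_apply [LocallyOfFiniteType B.hom]
    (p : ↥(Proj (homogeneousSubmodule (Fin (N + 1))
      (IsLocalRing.ResidueField (B.left.presheaf.stalk (x : B.left)))))) :
    height ((Proj.map (mapGraded Γ(B.left, U)
        (IsLocalRing.ResidueField (B.left.presheaf.stalk (x : B.left))) (Fin (N + 1)))
        (irrelevant_le_map Γ(B.left, U)
          (IsLocalRing.ResidueField (B.left.presheaf.stalk (x : B.left))) (Fin (N + 1))) ≫
        openPiece N B hU).base p) = height (x : B.left) + height p := by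
  -- notation
  let κb : Type u := IsLocalRing.ResidueField (B.left.presheaf.stalk (x : B.left))
  let Pb : Scheme.{u} := Proj (homogeneousSubmodule (Fin (N + 1)) κb)
  let σ : Pb ⟶ ((projectiveSpace N k) ⊗ B).left :=
    Proj.map (mapGraded Γ(B.left, U) κb (Fin (N + 1))) (irrelevant_le_map Γ(B.left, U) κb (Fin (N + 1))) ≫
      openPiece N B hU
  let κp : Type u := Pb.residueField p
  -- instances
  haveI : IsProper (projectiveSpace N k).hom := isProper_projectiveSpace N k
  haveI : LocallyOfFiniteType ((projectiveSpace N k) ⊗ B).hom :=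
    inferInstanceAs (LocallyOfFiniteType (pullback.fst (projectiveSpace N k).hom B.hom ≫
      (projectiveSpace N k).hom))
  haveI : IsProper (projToSpec (Fin (N + 1)) κb) := isProper_projToSpec (Fin (N + 1)) κb
  haveI : IsPreimmersion (B.left.fromSpecResidueField (x : B.left)) := inferInstance
  haveI hσ : IsPreimmersion σ :=
    MorphismProperty.of_isPullback (isPullback_fibreSlice N B hU x).flip
      (inferInstanceAs (IsPreimmersion (B.left.fromSpecResidueField (x : B.left))))
  -- the canonical algebra structures `k → κ(b)`, `κ(b) → κ(p)` and their composite
  letI algb' : Algebra k (B.left.residueField (x : B.left)) :=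
    ((Scheme.ΓSpecIso (CommRingCat.of k)).inv ≫ B.hom.appTop ≫ B.left.Γevaluation (x : B.left)).hom.toAlgebra
  letI algb : Algebra k κb := algb'
  have halgb : Spec.map (CommRingCat.ofHom (algebraMap k (B.left.residueField (x : B.left)))) =
      B.left.fromSpecResidueField (x : B.left) ≫ B.hom :=
    Scheme.SpecMap_ΓSpecIso_inv_appTop_Γevaluation B.hom (x : B.left)
  letI algp : Algebra κb κp :=
    ((Scheme.ΓSpecIso (CommRingCat.of κb)).inv ≫ (projToSpec (Fin (N + 1)) κb).appTop ≫
      Pb.Γevaluation p).hom.toAlgebra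
  have halgp : Spec.map (CommRingCat.ofHom (algebraMap κb κp)) =
      Pb.fromSpecResidueField p ≫ projToSpec (Fin (N + 1)) κb :=
    Scheme.SpecMap_ΓSpecIso_inv_appTop_Γevaluation (projToSpec (Fin (N + 1)) κb) p
  letI algkp : Algebra k κp := ((algebraMap κb κp).comp (algebraMap k κb)).toAlgebra
  haveI : IsScalarTower k κb κp := IsScalarTower.of_algebraMap_eq fun _ => rfl
  -- (1) `dim (σ p) = trdeg_k κ(p)` through the preimmersion `Spec κ(p) → ℙᴺ ×ₖ B`
  let g : Spec (CommRingCat.of κp) ⟶ ((projectiveSpace N k) ⊗ B).left := Pb.fromSpecResidueField p ≫ σ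
  haveI : IsPreimmersion g := inferInstanceAs (IsPreimmersion (Pb.fromSpecResidueField p ≫ σ))
  have hg : g ≫ ((projectiveSpace N k) ⊗ B).hom = Spec.map (CommRingCat.ofHom (algebraMap k κp)) := by
    have hw : σ ≫ (CartesianMonoidalCategory.snd (projectiveSpace N k) B).left =
        projToSpec (Fin (N + 1)) κb ≫ B.left.fromSpecResidueField (x : B.left) :=
      (isPullback_fibreSlice N B hU x).w
    have hsnd : ((projectiveSpace N k) ⊗ B).hom =
        (CartesianMonoidalCategory.snd (projectiveSpace N k) B).left ≫ B.hom :=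
      (Over.w (CartesianMonoidalCategory.snd (projectiveSpace N k) B)).symm
    calc g ≫ ((projectiveSpace N k) ⊗ B).hom
        = Pb.fromSpecResidueField p ≫ (σ ≫
            (CartesianMonoidalCategory.snd (projectiveSpace N k) B).left) ≫ B.hom := by
          rw [hsnd]; simp only [g, Category.assoc]
      _ = (Pb.fromSpecResidueField p ≫ projToSpec (Fin (N + 1)) κb) ≫
            (B.left.fromSpecResidueField (x : B.left) ≫ B.hom) := by
          rw [hw]; simp only [Category.assoc]
      _ = Spec.map (CommRingCat.ofHom (algebraMap κb κp)) ≫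
            Spec.map (CommRingCat.ofHom (algebraMap k (B.left.residueField (x : B.left)))) := by
          exact congrArg₂ (· ≫ ·) halgp.symm halgb.symm
      _ = Spec.map (CommRingCat.ofHom (algebraMap k κp)) := by
          rw [← Spec.map_comp]; rfl
  have h1 := Scheme.height_eq_toENat_trdeg_of_isPreimmersion ((projectiveSpace N k) ⊗ B).hom g hg
  have hgpt : g.base (IsLocalRing.closedPoint κp) = σ.base p := by
    change σ.base ((Pb.fromSpecResidueField p).base (IsLocalRing.closedPoint κp)) = _
    rw [Scheme.fromSpecResidueField_apply]
  rw [hgpt] at h1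
  -- (2) `dim b = trdeg_k κ(b)`, (3) `dim p = trdeg_{κ(b)} κ(p)`
  have h2 := Scheme.height_eq_toENat_trdeg_residueField B.hom (x : B.left) halgb
  have h3 := Scheme.height_eq_toENat_trdeg_residueField (projToSpec (Fin (N + 1)) κb) p halgp
  -- additivity of transcendence degree
  have hadd : Algebra.trdeg k κb + Algebra.trdeg κb κp = Algebra.trdeg k κp := trdeg_add_eq k κb (A := κp)
  have h2' : height (x : B.left) = Cardinal.toENat (Algebra.trdeg k κb) := h2
  change height (σ.base p) = _
  rw [h1, h2', h3, ← map_add, hadd]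

attribute [local instance] functionFieldAlgebra in
/-- **Vertical components over a base point are lines of the fibre — core form**: as
`exists_fibre_linePoint_of_vertical` below, with the hypothesis on the integral vectors stated
directly as `lin (wvᵢ) ∈ 𝔭 λ'` (no auxiliary forms `μ`). [cite: TianZong2014, proofs of Prop. 3.1 and Prop. 7.2] -/
theorem exists_fibre_linePoint_of_vertical_of_mem [IsIntegral B.left] [LocallyOfFiniteType B.hom] (hN : 1 ≤ N)
    (ι : Proj (homogeneousSubmodule (Fin (N + 1)) B.left.functionField) ⟶
      ((projectiveSpace N k) ⊗ B).left)
    (h₁ : ι ≫ (CartesianMonoidalCategory.fst (projectiveSpace N k) B).left =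
      Proj.map (mapGraded k B.left.functionField (Fin (N + 1)))
        (irrelevant_le_map k B.left.functionField (Fin (N + 1))))
    (h₂ : ι ≫ (CartesianMonoidalCategory.snd (projectiveSpace N k) B).left =
      projToSpec (Fin (N + 1)) B.left.functionField ≫ B.left.fromSpecStalk (genericPoint B.left))
    (lam : ↥(Proj (homogeneousSubmodule (Fin (N + 1)) B.left.functionField)))
    {w : ↥((projectiveSpace N k) ⊗ B).left} (hw : w ∈ closure {ι.base lam})
    (hwb : (CartesianMonoidalCategory.snd (projectiveSpace N k) B).left.base w = (x : B.left))
    (hfin : height (x : B.left) ≠ ⊤) (hheight : height w = height (x : B.left) + 1)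
    (wv : Fin (N - 1) → Fin (N + 1) → B.left.presheaf.stalk (x : B.left))
    (hwmem : ∀ i, lin (Literature.LinearAlgebra.toFrac (B.left.presheaf.stalk (x : B.left))
      B.left.functionField (wv i)) ∈
      ProjectiveSpectrum.asHomogeneousIdeal (𝒜 := homogeneousSubmodule (Fin (N + 1)) B.left.functionField) lam)
    (hliO : LinearIndependent (IsLocalRing.ResidueField (B.left.presheaf.stalk (x : B.left)))
      fun i j => IsLocalRing.residue (B.left.presheaf.stalk (x : B.left)) (wv i j)) :
    ∃ hLli : LinearIndependent (IsLocalRing.ResidueField (B.left.presheaf.stalk (x : B.left)))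
        (fun i => lin fun j => IsLocalRing.residue (B.left.presheaf.stalk (x : B.left)) (wv i j)),
      (Proj.map (mapGraded Γ(B.left, U)
        (IsLocalRing.ResidueField (B.left.presheaf.stalk (x : B.left))) (Fin (N + 1)))
        (irrelevant_le_map Γ(B.left, U)
          (IsLocalRing.ResidueField (B.left.presheaf.stalk (x : B.left))) (Fin (N + 1))) ≫
        openPiece N B hU).base
          (linearSubspacePoint
            (fun i => lin fun j => IsLocalRing.residue (B.left.presheaf.stalk (x : B.left)) (wv i j))
            hLli (fun _ => isHomogeneous_lin _) (Nat.sub_le N 1)) = w := by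
  obtain ⟨p, hp, hLli, hmem⟩ := exists_fibre_forms_of_vertical_of_mem N B hU x ι h₁ h₂ lam hw
    hwb wv hwmem hliO
  refine ⟨hLli, ?_⟩
  -- `dim p = 1`
  have hdim := height_fibreSlice_apply N B hU x p
  rw [hp, hheight] at hdim
  have hp1 : height p = 1 := ((add_right_inj_of_ne_top hfin).1 hdim).symm
  -- `p` lies on the line `V₊(L♭)` and has its dimension, so it is its generic point
  have hpmem : p ∈ ProjectiveSpectrum.zeroLocus
      (homogeneousSubmodule (Fin (N + 1)) (IsLocalRing.ResidueField (B.left.presheaf.stalk (x : B.left))))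
      (Set.range fun i => lin fun j =>
        IsLocalRing.residue (B.left.presheaf.stalk (x : B.left)) (wv i j)) := by
    rintro _ ⟨i, rfl⟩
    exact hmem i
  have hpeq : p = linearSubspacePoint
      (fun i => lin fun j => IsLocalRing.residue (B.left.presheaf.stalk (x : B.left)) (wv i j))
      hLli (fun _ => isHomogeneous_lin _) (Nat.sub_le N 1) := by
    by_contra hne
    have hlt := height_lt_of_mem_zeroLocus _ hLli (fun _ => isHomogeneous_lin _) (Nat.sub_le N 1)
      hpmem hne
    have hlt' : (1 : ℕ∞) < ((N - (N - 1) : ℕ) : ℕ∞) := lt_of_eq_of_lt hp1.symm hlt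
    rw [show N - (N - 1) = 1 by omega, Nat.cast_one] at hlt'
    exact lt_irrefl _ hlt'
  rw [← hpeq]
  exact hp

attribute [local instance] functionFieldAlgebra in
/-- **Vertical components over a base point are lines of the fibre.** In the setting of
`exists_fibre_forms_of_vertical` (`Motives/FibreVerticalLines`) with `N - 1` forms (a LINE of the
generic fibre) and `B` locally of finite type: a point `w ∈ ℙᴺ ×ₖ B` over `b`, of dimension
`dim b + 1` (`dim b < ∞`), in the closure of the line, is `σ_b` of the generic point of the
`κ(b)`-LINE `V₊(L♭) ⊆ ℙᴺ_{κ(b)}` cut out by the reduced equations (`height_fibreSlice_apply` and the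
dimension of linear subspaces). [cite: TianZong2014, proofs of Prop. 3.1 and Prop. 7.2] -/
theorem exists_fibre_linePoint_of_vertical [IsIntegral B.left] [LocallyOfFiniteType B.hom] (hN : 1 ≤ N)
    (ι : Proj (homogeneousSubmodule (Fin (N + 1)) B.left.functionField) ⟶
      ((projectiveSpace N k) ⊗ B).left)
    (h₁ : ι ≫ (CartesianMonoidalCategory.fst (projectiveSpace N k) B).left =
      Proj.map (mapGraded k B.left.functionField (Fin (N + 1)))
        (irrelevant_le_map k B.left.functionField (Fin (N + 1))))
    (h₂ : ι ≫ (CartesianMonoidalCategory.snd (projectiveSpace N k) B).left =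
      projToSpec (Fin (N + 1)) B.left.functionField ≫ B.left.fromSpecStalk (genericPoint B.left))
    (μ : Fin (N - 1) → MvPolynomial (Fin (N + 1)) B.left.functionField)
    (hμhom : ∀ l, (μ l).IsHomogeneous 1)
    (lam : ↥(Proj (homogeneousSubmodule (Fin (N + 1)) B.left.functionField)))
    (hlam : ∀ l, μ l ∈ ProjectiveSpectrum.asHomogeneousIdeal
      (𝒜 := homogeneousSubmodule (Fin (N + 1)) B.left.functionField) lam)
    {w : ↥((projectiveSpace N k) ⊗ B).left} (hw : w ∈ closure {ι.base lam})
    (hwb : (CartesianMonoidalCategory.snd (projectiveSpace N k) B).left.base w = (x : B.left))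
    (hfin : height (x : B.left) ≠ ⊤) (hheight : height w = height (x : B.left) + 1)
    (wv : Fin (N - 1) → Fin (N + 1) → B.left.presheaf.stalk (x : B.left))
    (hwv : ∀ i, Literature.LinearAlgebra.toFrac (B.left.presheaf.stalk (x : B.left))
      B.left.functionField (wv i) ∈
      Submodule.span B.left.functionField
        (Set.range fun (l : Fin (N - 1)) (j : Fin (N + 1)) => coeff (Finsupp.single j 1) (μ l)))
    (hliO : LinearIndependent (IsLocalRing.ResidueField (B.left.presheaf.stalk (x : B.left)))
      fun i j => IsLocalRing.residue (B.left.presheaf.stalk (x : B.left)) (wv i j)) :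
    ∃ hLli : LinearIndependent (IsLocalRing.ResidueField (B.left.presheaf.stalk (x : B.left)))
        (fun i => lin fun j => IsLocalRing.residue (B.left.presheaf.stalk (x : B.left)) (wv i j)),
      (Proj.map (mapGraded Γ(B.left, U)
        (IsLocalRing.ResidueField (B.left.presheaf.stalk (x : B.left))) (Fin (N + 1)))
        (irrelevant_le_map Γ(B.left, U)
          (IsLocalRing.ResidueField (B.left.presheaf.stalk (x : B.left))) (Fin (N + 1))) ≫
        openPiece N B hU).base
          (linearSubspacePoint
            (fun i => lin fun j => IsLocalRing.residue (B.left.presheaf.stalk (x : B.left)) (wv i j))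
            hLli (fun _ => isHomogeneous_lin _) (Nat.sub_le N 1)) = w := by
  classical
  -- the `K`-forms `lin (wv i)` lie in `𝔭 λ'` (through the span of the `μ l`)
  let vμ : Fin (N - 1) → Fin (N + 1) → B.left.functionField := fun l j => coeff (Finsupp.single j 1) (μ l)
  have hvμ : ∀ l, lin (vμ l) = μ l := fun l => (eq_lin_of_isHomogeneous_one (hμhom l)).symm
  have hwmem : ∀ i, lin (Literature.LinearAlgebra.toFrac (B.left.presheaf.stalk (x : B.left))
      B.left.functionField (wv i)) ∈
      ProjectiveSpectrum.asHomogeneousIdeal (𝒜 := homogeneousSubmodule (Fin (N + 1)) B.left.functionField) lam := by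
    intro i
    let I : Submodule B.left.functionField (MvPolynomial (Fin (N + 1)) B.left.functionField) :=
      ((ProjectiveSpectrum.asHomogeneousIdeal
        (𝒜 := homogeneousSubmodule (Fin (N + 1)) B.left.functionField) lam).toIdeal).restrictScalars
          B.left.functionField
    have hle : Submodule.span B.left.functionField (Set.range vμ) ≤
        I.comap (linMap (k := B.left.functionField) (N := N)) := by
      refine Submodule.span_le.mpr ?_
      rintro _ ⟨l, rfl⟩
      change lin (vμ l) ∈ (ProjectiveSpectrum.asHomogeneousIdeal
        (𝒜 := homogeneousSubmodule (Fin (N + 1)) B.left.functionField) lam).toIdeal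
      rw [hvμ]
      exact hlam l
    exact hle (hwv i)
  exact exists_fibre_linePoint_of_vertical_of_mem N B hU x hN ι h₁ h₂ lam hw hwb hfin hheight wv hwmem hliO

end ProjFamily

end Literature.AlgebraicGeometry.Motives

end
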